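import Summits.BirchSwinnertonDyer.BirchSwinnertonDyer.Theorems.AdditiveKolyvaginRoadLowerHalfTwistOfKuriharaRoad
import Literature.NumberTheory.EllipticCurves.ModularSymbolsManinDrinfeldGeneralProofs
import Literature.NumberTheory.EllipticCurves.ModularCurveRealPeriodProofs
import HarnessLib

/-!
# Route `AdditiveKolyvaginRoad`, crux KS′ `LevelKolyvaginSystemsAdditive` (item stmt-BirchSwinnertonDyer-21396): A RATIONAL PLUS-SYMBOL
# TABLE EXISTS FOR EVERY PARAMETRISATION WITH NON-ZERO MANIN CONSTANT — discharging the `ms`-half of the binder `hDt` of the Kurihara-road door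
# (sequel of `…LowerHalfTwistOfKuriharaRoad.lean`; cell `pub/bsd-wall`, width seat `bsd-wall-akr-p2x-w4` g6; `--supports stmt-BirchSwinnertonDyer-21396`, helper)

THEOREMS ONLY (no definition, no named fact, no `sorry`).  BSD is not proved by any of this.

THE POINT.  The door `KuriharaRoad.lowerHalf_twist_of_kuriharaRoad` (p648775) displays, for every minimal twist model `Wd`, the binder
`hDt`: «a parametrisation `Dt′` with `p ∤ c(Dt′)` AND a rational plus-symbol table `ms` with `Re{∞, r}_{f} = ms(r)·Ω(Wd)` for all `r ∈ ℚ`»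
(the normalisation of Kim–Nakamura's Kurihara numbers in the card's sketch).  The second half is a THEOREM of the tree's modular-symbol
apparatus, for ANY parametrisation datum `D` of ANY elliptic `W/ℚ` with `c(D) ≠ 0` (in particular whenever `p ∤ c(D)`):
Manin–Drinfeld (`exists_nsmul_modularSymbol_mem_periodLattice_holds`: `n·{∞,r}_f ∈ Λ_f`, PROVED in the tree), `c·Λ_f ⊆ Λ_E`
(`D.smul_periodLattice_le`), and `re Λ_E ⊆ ℤ·Ω(W)/2` (`D.exists_re_eq_int_mul_realPeriodRat_div_two`) give
`Re{∞,r}_f = (k / 2cn)·Ω(W)` with `k ∈ ℤ`.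

* `exists_rational_plusSymbolTable` — `c(D) ≠ 0 ⟹ ∃ ms : ℚ → ℚ, ∀ r, Re (modularSymbol D.f r) = ms r · W.realPeriodRat`.
* `lowerHalf_twist_of_kuriharaRoad_of_manin` — the door with `hDt` REDUCED to «∃ Dt′, p ∤ c(Dt′)» for each minimal twist model
  (modularity + Manin: PUB-type), everything else as in p648775.

References (locators only): [cite: Manin1972, Cor. 3.6] [cite: CremonaAlgorithms1997, §2.8 (p. 26)] [cite: KimNakamura2020, Thm 1.7].
-/

-- single-conjunct summit: `Summit.BirchSwinnertonDyer.BirchSwinnertonDyer.…` repeats the name by design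
set_option linter.dupNamespace false
set_option autoImplicit false

noncomputable section

open scoped Classical

namespace Summit.BirchSwinnertonDyer.BirchSwinnertonDyer.Theorems.AdditiveKoly.KuriharaRoad

open WeierstrassCurve NumberField
  Literature.NumberTheory.EllipticCurves Literature.NumberTheory.EllipticCurves.ModularForms
  Literature.NumberTheory.EllipticCurves.Rank1Residual Literature.NumberTheory.EllipticCurves.Rank1Residual.Typed

/-! ## §1 The rational plus-symbol table -/

/-- **A rational plus-symbol table exists** for every modular parametrisation datum `D` of an elliptic `W/ℚ` with non-zero Manin constant:
`∃ ms : ℚ → ℚ, ∀ r, Re{∞, r}_{f_D} = ms(r) · Ω(W)`.  Proof: `n·{∞,r} ∈ Λ_f` (Manin–Drinfeld, tree theorem), `c·Λ_f ⊆ Λ_E`, `re Λ_E ⊆ ℤ·Ω(W)/2`,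
so `c n · Re{∞,r} = k·Ω(W)/2` and `Re{∞,r} = (k/(2cn))·Ω(W)`. [cite: Manin1972, Cor. 3.6] [cite: CremonaAlgorithms1997, §2.8 (p. 26)] -/
theorem exists_rational_plusSymbolTable (W : WeierstrassCurve ℚ) [W.IsElliptic] {N : ℕ} [NeZero N]
    (D : ModularParametrizationData W N) (hc : D.c ≠ 0) :
    ∃ ms : ℚ → ℚ, ∀ r : ℚ, (modularSymbol D.f r).re = (ms r : ℝ) * W.realPeriodRat := by
  have key : ∀ r : ℚ, ∃ q : ℚ, (modularSymbol D.f r).re = (q : ℝ) * W.realPeriodRat := by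
    intro r
    obtain ⟨n, hn, hmem⟩ := exists_nsmul_modularSymbol_mem_periodLattice_holds D.f r
    have hz : (D.c : ℂ) * (n • modularSymbol D.f r) ∈ D.L.lattice := D.smul_periodLattice_le _ hmem
    obtain ⟨k, hk⟩ := D.exists_re_eq_int_mul_realPeriodRat_div_two hz
    have hre : ((D.c : ℂ) * (n • modularSymbol D.f r)).re = (D.c : ℝ) * (n : ℝ) * (modularSymbol D.f r).re := by
      rw [nsmul_eq_mul, ← mul_assoc, show ((D.c : ℂ) * (n : ℂ)) = (((D.c : ℝ) * (n : ℝ) : ℝ) : ℂ) by push_cast; ring,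
        Complex.re_ofReal_mul]
    rw [hre] at hk
    have hcn : (D.c : ℝ) * (n : ℝ) ≠ 0 := mul_ne_zero (by exact_mod_cast hc) (by exact_mod_cast hn.ne')
    refine ⟨(k : ℚ) / (2 * (D.c : ℚ) * (n : ℚ)), ?_⟩
    push_cast
    field_simp
    linear_combination 2 * hk
  choose ms hms using key
  exact ⟨ms, hms⟩

/-! ## §2 The door with the plus-symbol table discharged -/

/-- **LOW₀ FOR THE TWIST FROM THE KURIHARA ROAD, Manin-only form of `hDt`.**  As `lowerHalf_twist_of_kuriharaRoad` (p648775), with the binder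
`hDt` REDUCED to: every globally minimal model `Wd = Cd • E^{(d_K)}` has a modular parametrisation `Dt′` (level `N_{Wd}`) with `p ∤ c(Dt′)`
(modularity + Manin); the rational plus-symbol table is supplied by `exists_rational_plusSymbolTable`. [cite: KimNakamura2020, Thm 1.7]
[cite: Manin1972, Cor. 3.6] -/
theorem lowerHalf_twist_of_kuriharaRoad_of_manin (W : WeierstrassCurve ℚ) [W.IsElliptic] [W.IsGloballyMinimal]
    (p : ℕ) [hp : Fact p.Prime] (K : Type) [Field K] [NumberField K]
    (Kur : ∀ (X : WeierstrassCurve ℚ) [NeZero (X.conductorNorm ℤ)],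
      ModularParametrizationData X (X.conductorNorm ℤ) → (ℚ → ℚ) → Prop)
    (hKN : ∀ (X : WeierstrassCurve ℚ) [X.IsElliptic] [X.IsGloballyMinimal] [NeZero (X.conductorNorm ℤ)]
      (Dt : ModularParametrizationData X (X.conductorNorm ℤ)) (ms : ℚ → ℚ),
      7 < p → Addv X p → X.HasSurjectiveModNGaloisRep p → ¬ p ∣ X.tamagawaProduct →
      (∀ (ℓ : ℕ) [Fact ℓ.Prime], X.HasMultiplicativeReductionAtPrime ℓ → ¬ p ∣ (ℓ - 1) * (ℓ + 1)) →
      ¬ (p : ℤ) ∣ Dt.c → X.analyticRank = 0 →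
      (∀ r : ℚ, (modularSymbol Dt.f r).re = (ms r : ℝ) * X.realPeriodRat) →
      Kur X Dt ms → MissingLowerBoundAt X p)
    (hC : ∀ (X : WeierstrassCurve ℚ) [X.IsElliptic] [X.IsGloballyMinimal] [NeZero (X.conductorNorm ℤ)]
      (Dt : ModularParametrizationData X (X.conductorNorm ℤ)) (ms : ℚ → ℚ),
      5 ≤ p → ¬ X.HasCM → Addv X p → X.HasSurjectiveModNGaloisRep p → X.analyticRank = 0 →
      (∀ r : ℚ, (modularSymbol Dt.f r).re = (ms r : ℝ) * X.realPeriodRat) → Kur X Dt ms)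
    (hmod : hasEntireLFunction_rat) (h7 : 7 < p) (hadd : Addv W p) (hs : W.HasSurjectiveModNGaloisRep p) (hCM : ¬ W.HasCM)
    (htam : ¬ p ∣ W.tamagawaProduct)
    (hmult : ∀ (ℓ : ℕ) [Fact ℓ.Prime], W.HasMultiplicativeReductionAtPrime ℓ → ¬ p ∣ (ℓ - 1) * (ℓ + 1))
    (hK : IsImaginaryQuadratic K) (hodd : Odd (NumberField.discr K)) (hH : SatisfiesHeegnerHypothesis (W.conductorNorm ℤ) K)
    (hL : (W.quadraticTwist (NumberField.discr K : ℚ)).entireLFunction 1 ≠ 0)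
    (hManin : ∀ (Wd : WeierstrassCurve ℚ) [Wd.IsElliptic] [Wd.IsGloballyMinimal] [NeZero (Wd.conductorNorm ℤ)] (Cd : VariableChange ℚ),
      Cd • W.quadraticTwist (NumberField.discr K : ℚ) = Wd →
      ∃ Dt' : ModularParametrizationData Wd (Wd.conductorNorm ℤ), ¬ (p : ℤ) ∣ Dt'.c) :
    ∀ (Wd : WeierstrassCurve ℚ) [Wd.IsElliptic] [Wd.IsGloballyMinimal] (Cd : VariableChange ℚ),
      Cd • W.quadraticTwist (NumberField.discr K : ℚ) = Wd → MissingLowerBoundAt Wd p := by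
  refine lowerHalf_twist_of_kuriharaRoad W p K Kur hKN hC hmod h7 hadd hs hCM htam hmult hK hodd hH hL ?_
  intro Wd _ _ _ Cd hWd
  obtain ⟨Dt', hc'⟩ := hManin Wd Cd hWd
  have hc0 : Dt'.c ≠ 0 := fun h ↦ hc' (by rw [h]; exact dvd_zero _)
  obtain ⟨ms, hms⟩ := exists_rational_plusSymbolTable Wd Dt' hc0
  exact ⟨Dt', ms, hc', hms⟩

end Summit.BirchSwinnertonDyer.BirchSwinnertonDyer.Theorems.AdditiveKoly.KuriharaRoad

end
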